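import Mathlib
import Summits.ValiantsHypothesis.ValiantsHypothesis.Theorems.ValuativeGCTCutBitesHwExtraction
import Summits.ValiantsHypothesis.ValiantsHypothesis.Theorems.ValuativeGCTNoValuativeFlipBoundedLength

/-!
# Four-row weight support (det side of the four-row count)

Wall-breaker axis k3 (det-orbit-closure multiplicity bounds) for crux `ValuativeGCT.ValuativeFlip`
(stmt-ValiantsHypothesis-12624), line `four-row-count`.  The crux's Borel clause is semi-invariance
`G(g⁻¹ A) = χ(g) G(A)` for upper triangular `g ∈ GL(W)`, `W = ℂ^{m×m}` indexing the ROW SLOTS `j` of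
`A ∈ End W` (variables `X (j, i)`).  Torus weights of monomials (`hwx_weight_eq_neg_rowDegrees`) show
that a semi-invariant of weight `χ` only involves slots `j` with `χ j ≠ 0` (`frw_mem_supported`); for
`χ = λ* = (dualOfPartition (m*m) λ).toMatIdx` with `ℓ(λ) ≤ 4` these are among the last four slots
(`m² ≤ idx j + 4`, `fourRowHwspLeRows`) — the det-side half of the `GL₄`-bridge `stub_fourRowBridge`;
the numerical bounds that follow (with the four-row slice bound) are in `…FourRowWeightBound`.
Elementary; no named facts are used.
-/

set_option linter.dupNamespace false

namespace Summit.ValiantsHypothesis.ValiantsHypothesis.Theorems.ValuativeFlip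

open MvPolynomial
open scoped BigOperators Matrix
open Literature.NumberTheory.DiophantineGeometry
open Summit.ValiantsHypothesis.ValiantsHypothesis.Theorems.CutBitesAdjugate
open Summit.ValiantsHypothesis.ValiantsHypothesis.Theorems.NoValuativeFlip

noncomputable section

/-- **Weight support.** A `B`-semi-invariant `G` of weight `χ` for the left translation
`X (j, i) ↦ ∑ l, (g⁻¹) j l • X (l, i)` only involves the row slots `j` with `χ j ≠ 0`: the torus
weight of every monomial of `G` is minus its vector of row degrees (`hwx_weight_eq_neg_rowDegrees`).
[folklore: Fulton–Harris §15.5] -/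
theorem frw_mem_supported {m : ℕ} (χ : Weight (MatIdx m))
    (G : MvPolynomial (MatIdx m × MatIdx m) ℂ)
    (hG : ∀ g : Matrix.GeneralLinearGroup (MatIdx m) ℂ, IsUpperTriangular g →
      MvPolynomial.aeval (R := ℂ) (fun p : MatIdx m × MatIdx m =>
        ∑ l : MatIdx m, ((g⁻¹ : Matrix.GeneralLinearGroup (MatIdx m) ℂ) :
          Matrix (MatIdx m) (MatIdx m) ℂ) p.1 l •
            (MvPolynomial.X (l, p.2) : MvPolynomial (MatIdx m × MatIdx m) ℂ)) G = weightChar χ g • G) :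
    G ∈ MvPolynomial.supported ℂ {p : MatIdx m × MatIdx m | χ p.1 ≠ 0} := by
  classical
  rw [mem_supported]
  intro p hp
  rw [Finset.mem_coe, mem_vars_iff_mem_support] at hp
  obtain ⟨s, hs, hps⟩ := hp
  have hχ := hwx_weight_eq_neg_rowDegrees (fun t ht => hG t ht.isUpperTriangular)
    (mem_support_iff.mp hs)
  intro h0
  have h1 := congrFun hχ p.1
  rw [h0] at h1
  have hsum : (∑ q ∈ s.support with q.1 = p.1, s q) = 0 := by
    have h2 : ((∑ q ∈ s.support with q.1 = p.1, s q : ℕ) : ℤ) = 0 := by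
      have := h1.symm
      rwa [neg_eq_zero] at this
    exact_mod_cast h2
  have hsp : s p = 0 :=
    Finset.sum_eq_zero_iff.mp hsum p (Finset.mem_filter.mpr ⟨hps, rfl⟩)
  exact (Finsupp.mem_support_iff.mp hps) hsp

/-- **Four-row support of `λ*`-semi-invariants.** For a partition `λ` with at most four parts, every
`B`-semi-invariant of weight `λ* = (dualOfPartition (m*m) λ).toMatIdx` (the crux's clause,
verbatim) is a polynomial in the entries of the last four row slots (`m² ≤ idx j + 4`): `λ*`
vanishes at every lexicographic index below the last `ℓ(λ) ≤ 4` ones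
(`dualOfPartition_toMatIdx_eq_zero_of_lt`).  This is the det-side half of the `GL₄`-bridge of line
`four-row-count`. [folklore; BLMW 2011 §5.2] -/
theorem fourRowHwspLeRows : ∀ (m d : ℕ) (lam : Nat.Partition d), lam.parts.card ≤ 4 → (⨅ (g : Matrix.GeneralLinearGroup (MatIdx m) ℂ) (_ : IsUpperTriangular g), LinearMap.ker ((MvPolynomial.aeval fun p : MatIdx m × MatIdx m => ∑ l : MatIdx m, ((g⁻¹ : Matrix.GeneralLinearGroup (MatIdx m) ℂ) : Matrix (MatIdx m) (MatIdx m) ℂ) p.1 l • (MvPolynomial.X (l, p.2) : MvPolynomial (MatIdx m × MatIdx m) ℂ)).toLinearMap - weightChar ((Weight.dualOfPartition (m * m) lam).toMatIdx : Weight (MatIdx m)) g • (LinearMap.id : MvPolynomial (MatIdx m × MatIdx m) ℂ →ₗ[ℂ] MvPolynomial (MatIdx m × MatIdx m) ℂ))) ≤ Subalgebra.toSubmodule (MvPolynomial.supported ℂ {p : MatIdx m × MatIdx m | m * m ≤ (((matIdxEquiv m).symm p.1 : Fin (m * m)) : ℕ) + 4}) := by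
  intro m d lam hlam G hG
  have hG' : ∀ g : Matrix.GeneralLinearGroup (MatIdx m) ℂ, IsUpperTriangular g →
      MvPolynomial.aeval (R := ℂ) (fun p : MatIdx m × MatIdx m =>
        ∑ l : MatIdx m, ((g⁻¹ : Matrix.GeneralLinearGroup (MatIdx m) ℂ) :
          Matrix (MatIdx m) (MatIdx m) ℂ) p.1 l •
            (MvPolynomial.X (l, p.2) : MvPolynomial (MatIdx m × MatIdx m) ℂ)) G =
        weightChar ((Weight.dualOfPartition (m * m) lam).toMatIdx : Weight (MatIdx m)) g • G := by
    intro g hg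
    simp only [Submodule.mem_iInf, LinearMap.mem_ker, LinearMap.sub_apply, sub_eq_zero,
      AlgHom.toLinearMap_apply, LinearMap.smul_apply, LinearMap.id_coe, id_eq] at hG
    exact hG g hg
  have h1 := frw_mem_supported _ G hG'
  refine (supported_mono ?_) h1
  intro p hp
  simp only [Set.mem_setOf_eq] at hp ⊢
  by_contra hlt
  apply hp
  have h := dualOfPartition_toMatIdx_eq_zero_of_lt lam ((matIdxEquiv m).symm p.1) (by omega)
  rwa [OrderIso.apply_symm_apply] at h

end

end Summit.ValiantsHypothesis.ValiantsHypothesis.Theorems.ValuativeFlip
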